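import Literature.NumberTheory.Transcendental.CurvePeriodsEllipticIsogenousPathsProofs
import Literature.NumberTheory.Transcendental.ManyCurvePeriodsIsotypicHolds

/-!
# `RealOnePeriodRelations` (stmt-KontsevichZagierPeriods-10042), line `nash-retraction-thin-strip`,
# loop layer: stub `stub_hwLoopsFamily`

HUBER–WÜSTHOLZ, THEOREM 13.3 (2), FOR CLOSED PATHS ON AN ARBITRARY FINITE FAMILY OF ELLIPTIC
CURVES `E_{L i}` over `ℚ̄` (complex multiplication and isogenies allowed), together with closed
paths on `𝔾ₘ` and arbitrary paths on `𝔸¹`.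

* Phase A/B (`exists_family_normalForm`): every symbol is brought to normal form
  (`Ell.exists_loop_normalForm` curve by curve, `exists_rel_of_mulGroup_closed`,
  `exists_rel_of_affineLine`), so that modulo the `ℚ̄`-span of the elementary relations
  `c ∼ Σᵢ loopPart (L i) (A i) (B i) + Q • ℓ₁ + E • 𝟙` with algebraic coefficients.
* Phase C: the period of the normal form,
  `Σᵢ (2(Aᵢ₀ω₁⁽ⁱ⁾ + Aᵢ₁ω₂⁽ⁱ⁾) − 2(Bᵢ₀η₁⁽ⁱ⁾ + Bᵢ₁η₂⁽ⁱ⁾)) + 2πi·Q + E`, vanishes, and the isotypic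
  splitting `HuberWustholzIsotypicSplitting_holds` gives `E = Q = 0` and the vanishing of every
  isogeny-class block.
* Phase D (`span_loopPart_class`): a class block is a vanishing combination of CLOSED basic-loop
  symbols on curves isogenous to the class representative, hence in the span by
  `huberWustholzCurvePeriods_of_isogenousEllipticLoops`.
* Phase E (`sum_eq_sum_classes`): averaging over the classes, `Σⱼ Pⱼ = Σᵢ |Sᵢ|⁻¹ • Σ_{j ∈ Sᵢ} Pⱼ`
  for the isogeny classes `Sᵢ = {j | L i ~ L j}`, reassembles the loop part.

[cite: HuberWustholz2022, Thm 13.3 (2), Thm 15.3 (1),(3), §15.2.2]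
[cite: Masser1975, Ch. III Thm. III]
-/

noncomputable section

open scoped BigOperators
open MvPolynomial Complex
open Literature.NumberTheory.Transcendental Literature.NumberTheory.Transcendental.CurvePeriods

namespace Summit.KontsevichZagierPeriods.SymplecticScissors.RealOnePeriodRelations.LoopLayer

/-! ### The basic loops are closed; support and coefficients of the loop part -/

/-- **The basic loops `φ ∘ [g₀, g₀ + ω_j]` are closed**: the unit step of the level-`0` grid from
`(0, 0)` in direction `j` runs from `g₀` to `g₀ + ω_j`, and `φ = (℘, ℘′/2)` is `Λ`-periodic.
[folklore] -/
theorem stepPath_zero_closed (L : PeriodPair) (h₂ : IsAlgebraic ℚ L.g₂) (h₃ : IsAlgebraic ℚ L.g₃)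
    (j : Fin 2) :
    (Ell.stepPath L h₂ h₃ 0 (0, 0) j).toFun 1 = (Ell.stepPath L h₂ h₃ 0 (0, 0) j).toFun 0 := by
  simp only [Ell.stepPath, Ell.segPath_toFun]
  have e1 : Ell.vtx L 0 (0, 0) +
      ((1 : ℝ) : ℂ) * (Ell.vtx L 0 (Ell.nbr (0, 0) j) - Ell.vtx L 0 (0, 0)) =
      Ell.vtx L 0 (0, 0) + ![L.ω₁, L.ω₂] j := by
    fin_cases j
    · simp [Ell.vtx, Ell.gc]
      ring
    · simp [Ell.vtx, Ell.gc]
      ring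
  have e0 : Ell.vtx L 0 (0, 0) +
      ((0 : ℝ) : ℂ) * (Ell.vtx L 0 (Ell.nbr (0, 0) j) - Ell.vtx L 0 (0, 0)) =
      Ell.vtx L 0 (0, 0) := by
    push_cast
    ring
  rw [e1, e0]
  refine Ell.phi_add_of_mem L _ ?_
  fin_cases j
  · simpa using L.ω₁_mem_lattice
  · simpa using L.ω₂_mem_lattice

/-- **The loop part is supported on closed-path symbols on `E_L`** (the basic loops).
[folklore] -/
theorem loopPart_support (L : PeriodPair) (h₂ : IsAlgebraic ℚ L.g₂) (h₃ : IsAlgebraic ℚ L.g₃)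
    (A B : Fin 2 → ℂ) (t : PeriodSymbol) (ht : t ∈ (Ell.loopPart L h₂ h₃ A B).support) :
    t.Z = Ell.curve L ∧ t.γ.toFun 1 = t.γ.toFun 0 := by
  classical
  simp only [Ell.loopPart] at ht
  rcases Finset.mem_union.1 (Finsupp.support_add ht) with h | h
  · obtain ⟨j, -, hj⟩ := Finset.mem_biUnion.1 (Finsupp.support_finsetSum h)
    have h3 := (Finsupp.mem_support_single _ _ _).1 (Finsupp.support_smul hj)
    rw [h3.1]
    exact ⟨rfl, stepPath_zero_closed L h₂ h₃ j⟩
  · obtain ⟨j, -, hj⟩ := Finset.mem_biUnion.1 (Finsupp.support_finsetSum h)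
    have h3 := (Finsupp.mem_support_single _ _ _).1 (Finsupp.support_smul hj)
    rw [h3.1]
    exact ⟨rfl, stepPath_zero_closed L h₂ h₃ j⟩

/-- **The loop part has algebraic coefficients** when `A, B` are algebraic. [folklore] -/
theorem isAlgebraic_loopPart_apply (L : PeriodPair) (h₂ : IsAlgebraic ℚ L.g₂)
    (h₃ : IsAlgebraic ℚ L.g₃) {A B : Fin 2 → ℂ} (hA : ∀ j, IsAlgebraic ℚ (A j))
    (hB : ∀ j, IsAlgebraic ℚ (B j)) (t : PeriodSymbol) :
    IsAlgebraic ℚ (Ell.loopPart L h₂ h₃ A B t) := by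
  simp only [Ell.loopPart, Finsupp.add_apply, Finsupp.finsetSum_apply, Finsupp.smul_apply,
    smul_eq_mul]
  exact (isAlgebraic_finsetSum _ _ fun j _ => (hA j).mul (isAlgebraic_single_one_apply _ _)).add
    (isAlgebraic_finsetSum _ _ fun j _ => (hB j).mul (isAlgebraic_single_one_apply _ _))

/-! ### Phase D: an isogeny-class block of loop parts with vanishing period is in the span -/

/-- **A class block is in the span.** For a finite family `L` of lattices with algebraic
invariants, a finite set `S` of indices `j` with `L j` isogenous to a fixed `M` (algebraic
invariants), and algebraic `A j, B j`: if the period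
`Σ_{j ∈ S} (2(A j 0 ω₁⁽ʲ⁾ + A j 1 ω₂⁽ʲ⁾) − 2(B j 0 η₁⁽ʲ⁾ + B j 1 η₂⁽ʲ⁾))` of
`Σ_{j ∈ S} loopPart (L j) (A j) (B j)` vanishes, the combination is a `ℚ̄`-combination of the
elementary relations — it is supported on CLOSED basic loops on the curves `E_{L j}`, each
isogenous to `E_M` by an algebraic multiplier (`PeriodPair.IsIsogenousTo.exists_algebraic`), so
`huberWustholzCurvePeriods_of_isogenousEllipticLoops` applies.
[cite: HuberWustholz2022, Thm 13.3 (2), §13.2] -/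
theorem span_loopPart_class {k : ℕ} (L : Fin k → PeriodPair)
    (hL : ∀ i, IsAlgebraic ℚ (L i).g₂ ∧ IsAlgebraic ℚ (L i).g₃) (M : PeriodPair)
    (hM₂ : IsAlgebraic ℚ M.g₂) (hM₃ : IsAlgebraic ℚ M.g₃) (S : Finset (Fin k))
    (hS : ∀ j ∈ S, (L j).IsIsogenousTo M) (A B : Fin k → Fin 2 → ℂ)
    (hA : ∀ j i, IsAlgebraic ℚ (A j i)) (hB : ∀ j i, IsAlgebraic ℚ (B j i))
    (h0 : ∑ j ∈ S, (2 * (A j 0 * (L j).ω₁ + A j 1 * (L j).ω₂) -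
      2 * (B j 0 * (L j).η₁ + B j 1 * (L j).η₂)) = 0) :
    ∃ (n : ℕ) (ρ : Fin n → (PeriodSymbol →₀ ℂ)) (a : Fin n → ℂ),
      (∀ l, IsElementaryRelation (ρ l)) ∧ (∀ l, IsAlgebraic ℚ (a l)) ∧
      ∑ j ∈ S, Ell.loopPart (L j) (hL j).1 (hL j).2 (A j) (B j) = ∑ l, a l • ρ l := by
  classical
  refine huberWustholzCurvePeriods_of_isogenousEllipticLoops M hM₂ hM₃ _ (fun t => ?_)
    (fun t ht => ?_) ?_
  · rw [Finsupp.finsetSum_apply]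
    exact isAlgebraic_finsetSum _ _ fun j _ =>
      isAlgebraic_loopPart_apply (L j) (hL j).1 (hL j).2 (hA j) (hB j) t
  · obtain ⟨j, hj, hjt⟩ := Finset.mem_biUnion.1 (Finsupp.support_finsetSum ht)
    obtain ⟨hZ, hcl⟩ := loopPart_support (L j) (hL j).1 (hL j).2 (A j) (B j) t hjt
    obtain ⟨α, hα0, hαalg, hαL⟩ := (hS j hj).exists_algebraic (hL j).1 (hL j).2 hM₂ hM₃
    exact Or.inl ⟨L j, α, (hL j).1, (hL j).2, hα0, hαalg, hαL, hZ, hcl⟩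
  · rw [evalCombination_finsetSum, ← h0]
    exact Finset.sum_congr rfl fun j _ => Ell.evalCombination_loopPart (L j) (hL j).1 (hL j).2 _ _

/-! ### Phase E: averaging over the classes of an equivalence relation -/

/-- **Averaging over classes.** If `S i ∋ i` are the classes of an equivalence relation on a
finite index type (`j ∈ S i → S j = S i`), then `Σⱼ f j = Σᵢ |S i|⁻¹ • Σ_{j ∈ S i} f j`.
[folklore] -/
theorem sum_eq_sum_classes {ι V : Type*} [Fintype ι] [AddCommGroup V] [Module ℂ V]
    (S : ι → Finset ι) (hrefl : ∀ i, i ∈ S i) (hclass : ∀ i j, j ∈ S i → S j = S i)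
    (f : ι → V) :
    ∑ j, f j = ∑ i, ((S i).card : ℂ)⁻¹ • ∑ j ∈ S i, f j := by
  have hsymm : ∀ i j, j ∈ S i ↔ i ∈ S j := fun i j =>
    ⟨fun h => by rw [hclass i j h]; exact hrefl i, fun h => by rw [hclass j i h]; exact hrefl j⟩
  calc ∑ j, f j = ∑ j, ∑ _i ∈ S j, ((S j).card : ℂ)⁻¹ • f j := by
        refine Finset.sum_congr rfl fun j _ => ?_
        rw [Finset.sum_const, ← Nat.cast_smul_eq_nsmul ℂ, smul_smul, mul_inv_cancel₀, one_smul]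
        exact Nat.cast_ne_zero.2 (Finset.card_pos.2 ⟨j, hrefl j⟩).ne'
    _ = ∑ i, ∑ j ∈ S i, ((S j).card : ℂ)⁻¹ • f j := by
        refine Finset.sum_comm' fun j i => ?_
        simp only [Finset.mem_univ, true_and, and_true]
        exact hsymm j i
    _ = ∑ i, ((S i).card : ℂ)⁻¹ • ∑ j ∈ S i, f j := by
        refine Finset.sum_congr rfl fun i _ => ?_
        rw [Finset.smul_sum]
        exact Finset.sum_congr rfl fun j hj => by rw [hclass i j hj]

/-! ### Phases A–B: the normal form of a combination on the family -/

/-- **Normal form of a combination supported on closed paths on the curves `E_{L i}`, closed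
paths on `𝔾ₘ` and paths on `𝔸¹`.** Modulo the `ℚ̄`-span of the elementary relations,
`c ∼ Σᵢ loopPart (L i) (A i) (B i) + Q • ℓ₁ + E • 𝟙` with algebraic `A i j, B i j, Q, E`, where
`ℓ₁ = (𝔾ₘ, y dx, Λ_{1,1})` is the standard loop (period `2πi`) and `𝟙` the unit symbol: symbol by
symbol `Ell.exists_loop_normalForm` (on the curve `E_{L i}` carrying it),
`exists_rel_of_mulGroup_closed` and `exists_rel_of_affineLine`, then summation over the support.
[cite: HuberWustholz2022, §13.2 (pp. 122–125), §18.1 (p. 160)] -/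
theorem exists_family_normalForm {k : ℕ} (L : Fin k → PeriodPair)
    (hL : ∀ i, IsAlgebraic ℚ (L i).g₂ ∧ IsAlgebraic ℚ (L i).g₃)
    (c : PeriodSymbol →₀ ℂ) (hc : ∀ s, IsAlgebraic ℚ (c s))
    (hsupp : ∀ s ∈ c.support,
      (∃ i, s.Z = Ell.curve (L i) ∧ s.γ.toFun 1 = s.γ.toFun 0) ∨
        (s.Z = (⟨2, 1, ![X 0 * X 1 - 1]⟩ : CurveData) ∧ s.γ.toFun 1 = s.γ.toFun 0) ∨
        s.Z = CurveData.affineLine) :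
    ∃ (ℓ₁ : PeriodSymbol) (A B : Fin k → Fin 2 → ℂ) (Q E : ℂ), ℓ₁.period = 2 * Real.pi * I ∧
      (∀ i j, IsAlgebraic ℚ (A i j)) ∧ (∀ i j, IsAlgebraic ℚ (B i j)) ∧ IsAlgebraic ℚ Q ∧
      IsAlgebraic ℚ E ∧
      ∃ (n : ℕ) (ρ : Fin n → (PeriodSymbol →₀ ℂ)) (a : Fin n → ℂ),
        (∀ l, IsElementaryRelation (ρ l)) ∧ (∀ l, IsAlgebraic ℚ (a l)) ∧
        c - (∑ i, Ell.loopPart (L i) (hL i).1 (hL i).2 (A i) (B i) +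
          Q • Finsupp.single ℓ₁ (1 : ℂ) + E • Finsupp.single PeriodSymbol.unit (1 : ℂ)) =
          ∑ l, a l • ρ l := by
  classical
  -- the standard loop on `𝔾ₘ`
  obtain ⟨Λ₁, hΛ₁⟩ := exists_stdLoop isAlgebraic_one one_ne_zero (1 : ℤ)
  set ℓ₁ : PeriodSymbol := ⟨⟨2, 1, ![X 0 * X 1 - 1]⟩, isSmoothAffineCurve_mulGroup, ![X 1, 0],
    hasAlgCoeffs_ydx, Λ₁⟩ with hℓ₁
  have hℓ₁per : ℓ₁.period = 2 * Real.pi * I := by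
    rw [hℓ₁, period_ydx_stdLoop one_ne_zero 1 Λ₁ hΛ₁]
    simp
  -- Phase A: normal form of every symbol
  have key : ∀ s : PeriodSymbol, ∃ (A B : Fin k → Fin 2 → ℂ) (q e : ℂ), s ∈ c.support →
      ((∀ i j, IsAlgebraic ℚ (A i j)) ∧ (∀ i j, IsAlgebraic ℚ (B i j)) ∧ IsAlgebraic ℚ q ∧
        IsAlgebraic ℚ e ∧
        ∃ (n : ℕ) (ρ : Fin n → (PeriodSymbol →₀ ℂ)) (a : Fin n → ℂ),
          (∀ l, IsElementaryRelation (ρ l)) ∧ (∀ l, IsAlgebraic ℚ (a l)) ∧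
          Finsupp.single s (1 : ℂ) -
            ∑ i, Ell.loopPart (L i) (hL i).1 (hL i).2 (A i) (B i) -
            q • Finsupp.single ℓ₁ (1 : ℂ) - e • Finsupp.single PeriodSymbol.unit (1 : ℂ) =
            ∑ l, a l • ρ l) := by
    intro s
    by_cases hs : s ∈ c.support
    · have halg0 : ∀ (i : Fin k) (j : Fin 2), IsAlgebraic ℚ ((0 : Fin k → Fin 2 → ℂ) i j) :=
        fun _ _ => isAlgebraic_zero
      have hLP0 : ∑ i, Ell.loopPart (L i) (hL i).1 (hL i).2 ((0 : Fin k → Fin 2 → ℂ) i)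
          ((0 : Fin k → Fin 2 → ℂ) i) = 0 :=
        Finset.sum_eq_zero fun i _ => Ell.loopPart_zero (L i) (hL i).1 (hL i).2
      rcases hsupp s hs with ⟨i, hsZ, hcl⟩ | ⟨hsZ, hcl⟩ | hsA
      · obtain ⟨Z, hZ, ω, hω, γ⟩ := s
        dsimp only at hsZ hcl
        subst hsZ
        obtain rfl : hZ = Ell.smooth (L i) (hL i).1 (hL i).2 := rfl
        obtain ⟨A, B, e, hA, hB, he, hrel⟩ :=
          Ell.exists_loop_normalForm (L i) (hL i).1 (hL i).2 γ hcl ω hω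
        have hsingle : ∀ {F : Fin 2 → ℂ}, (∀ j, IsAlgebraic ℚ (F j)) →
            ∀ i' j, IsAlgebraic ℚ ((Pi.single i F : Fin k → Fin 2 → ℂ) i' j) := by
          intro F hF i' j
          by_cases h : i' = i
          · subst h
            simpa using hF j
          · simp [h, isAlgebraic_zero]
        have hsum1 : ∑ i', Ell.loopPart (L i') (hL i').1 (hL i').2
            ((Pi.single i A : Fin k → Fin 2 → ℂ) i') ((Pi.single i B : Fin k → Fin 2 → ℂ) i') =
            Ell.loopPart (L i) (hL i).1 (hL i).2 A B := by
          rw [Finset.sum_eq_single i (fun i' _ hi' => by simp [hi', Ell.loopPart_zero])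
            (fun h => (h (Finset.mem_univ i)).elim)]
          simp
        refine ⟨Pi.single i A, Pi.single i B, 0, e, fun _ =>
          ⟨hsingle hA, hsingle hB, isAlgebraic_zero, he, ?_⟩⟩
        obtain ⟨n, ρ, cf, hρ, hcf, hsum⟩ := hrel
        exact ⟨n, ρ, cf, hρ, hcf, by rw [hsum1, zero_smul, sub_zero, ← hsum]⟩
      · obtain ⟨q, hq, n, ρ, cf, hρ, hcf, hsum⟩ :=
          exists_rel_of_mulGroup_closed s hsZ hcl Λ₁ hΛ₁
        refine ⟨0, 0, q, 0, fun _ => ⟨halg0, halg0, hq, isAlgebraic_zero, ?_⟩⟩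
        exact ⟨n, ρ, cf, hρ, hcf, by rw [← hsum, hLP0, zero_smul, sub_zero, sub_zero]⟩
      · obtain ⟨π₀, hπ₀, -, hrel⟩ := exists_rel_of_affineLine s hsA
        refine ⟨0, 0, 0, π₀, fun _ => ⟨halg0, halg0, isAlgebraic_zero, hπ₀, ?_⟩⟩
        obtain ⟨n, ρ, cf, hρ, hcf, hsum⟩ := span_of_rel hrel
        exact ⟨n, ρ, cf, hρ, hcf, by rw [← hsum, hLP0, zero_smul, sub_zero, sub_zero]⟩
    · exact ⟨0, 0, 0, 0, fun h => (hs h).elim⟩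
  choose A B q e hkey using key
  -- Phase B: sum over the support
  obtain ⟨n, ρ, cf, hρ, hcf, hmain⟩ :
      ∃ (n : ℕ) (ρ : Fin n → (PeriodSymbol →₀ ℂ)) (a : Fin n → ℂ),
        (∀ l, IsElementaryRelation (ρ l)) ∧ (∀ l, IsAlgebraic ℚ (a l)) ∧
        ∑ s ∈ c.support, c s • (Finsupp.single s (1 : ℂ) -
          ∑ i, Ell.loopPart (L i) (hL i).1 (hL i).2 (A s i) (B s i) -
          q s • Finsupp.single ℓ₁ (1 : ℂ) - e s • Finsupp.single PeriodSymbol.unit (1 : ℂ)) =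
          ∑ l, a l • ρ l :=
    span_finsetSum _ _ fun s hs => span_smul (hc s) (hkey s hs).2.2.2.2
  have hc_eq : c = ∑ s ∈ c.support, c s • Finsupp.single s (1 : ℂ) := by
    conv_lhs => rw [← Finsupp.sum_single c]
    simp only [Finsupp.sum, Finsupp.smul_single_one]
  have hLPsum : ∑ s ∈ c.support, c s • ∑ i, Ell.loopPart (L i) (hL i).1 (hL i).2 (A s i) (B s i) =
      ∑ i, Ell.loopPart (L i) (hL i).1 (hL i).2 (∑ s ∈ c.support, c s • A s i)
        (∑ s ∈ c.support, c s • B s i) := by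
    simp only [Finset.smul_sum, Ell.smul_loopPart]
    rw [Finset.sum_comm]
    exact Finset.sum_congr rfl fun i _ => Ell.loopPart_finset_sum (L i) (hL i).1 (hL i).2 _ _ _
  have hident : ∑ s ∈ c.support, c s • (Finsupp.single s (1 : ℂ) -
        ∑ i, Ell.loopPart (L i) (hL i).1 (hL i).2 (A s i) (B s i) -
        q s • Finsupp.single ℓ₁ (1 : ℂ) - e s • Finsupp.single PeriodSymbol.unit (1 : ℂ)) =
      c - (∑ i, Ell.loopPart (L i) (hL i).1 (hL i).2 (∑ s ∈ c.support, c s • A s i)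
        (∑ s ∈ c.support, c s • B s i) +
        (∑ s ∈ c.support, c s * q s) • Finsupp.single ℓ₁ (1 : ℂ) +
        (∑ s ∈ c.support, c s * e s) • Finsupp.single PeriodSymbol.unit (1 : ℂ)) := by
    simp only [smul_sub, Finset.sum_sub_distrib, ← hc_eq, hLPsum, smul_smul, ← Finset.sum_smul]
    abel
  rw [hident] at hmain
  refine ⟨ℓ₁, fun i => ∑ s ∈ c.support, c s • A s i, fun i => ∑ s ∈ c.support, c s • B s i,
    ∑ s ∈ c.support, c s * q s, ∑ s ∈ c.support, c s * e s, hℓ₁per, fun i j => ?_, fun i j => ?_,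
    isAlgebraic_finsetSum _ _ fun s hs => (hc s).mul (hkey s hs).2.2.1,
    isAlgebraic_finsetSum _ _ fun s hs => (hc s).mul (hkey s hs).2.2.2.1, n, ρ, cf, hρ, hcf, hmain⟩
  · beta_reduce
    rw [Finset.sum_apply]
    exact isAlgebraic_finsetSum _ _ fun s hs => (hc s).mul ((hkey s hs).1 i j)
  · beta_reduce
    rw [Finset.sum_apply]
    exact isAlgebraic_finsetSum _ _ fun s hs => (hc s).mul ((hkey s hs).2.1 i j)

/-! ### The stub -/

/-- **Stub `stub_hwLoopsFamily`** — HUBER–WÜSTHOLZ 13.3 (2) FOR CLOSED PATHS ON AN ARBITRARY FINITE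
FAMILY OF ELLIPTIC CURVES (CM and isogenies allowed), with closed paths on `𝔾ₘ` and any paths on
`𝔸¹`: normal forms curve by curve (`exists_family_normalForm`), the isotypic splitting of the
vanishing period `Σⱼ (2(Aⱼ₀ω₁⁽ʲ⁾ + Aⱼ₁ω₂⁽ʲ⁾) − 2(Bⱼ₀η₁⁽ʲ⁾ + Bⱼ₁η₂⁽ʲ⁾)) + 2πi Q + E = 0`
(`HuberWustholzIsotypicSplitting_holds`: `E = Q = 0` and every isogeny-class block vanishes),
class by class `huberWustholzCurvePeriods_of_isogenousEllipticLoops` for the block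
(`span_loopPart_class`), and the classes are reassembled by averaging (`sum_eq_sum_classes`).
[cite: HuberWustholz2022, Thm 13.3 (2), Thm 15.3 (1),(3), §15.2.2]
[cite: Masser1975, Ch. III Thm. III] -/
theorem stub_hwLoopsFamily : ∀ (k : ℕ) (L : Fin k → PeriodPair),
    (∀ i, IsAlgebraic ℚ (L i).g₂ ∧ IsAlgebraic ℚ (L i).g₃) →
    ∀ (c : PeriodSymbol →₀ ℂ), (∀ s, IsAlgebraic ℚ (c s)) →
    (∀ s ∈ c.support,
      (∃ i, s.Z = Ell.curve (L i) ∧ s.γ.toFun 1 = s.γ.toFun 0) ∨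
        (s.Z = (⟨2, 1, ![X 0 * X 1 - 1]⟩ : CurveData) ∧ s.γ.toFun 1 = s.γ.toFun 0) ∨
        s.Z = CurveData.affineLine) →
    evalCombination c = 0 →
    ∃ (n : ℕ) (ρ : Fin n → (PeriodSymbol →₀ ℂ)) (a : Fin n → ℂ),
      (∀ l, IsElementaryRelation (ρ l)) ∧ (∀ l, IsAlgebraic ℚ (a l)) ∧ c = ∑ l, a l • ρ l := by
  intro k L hL c hc hsupp h0
  classical
  obtain ⟨ℓ₁, A, B, Q, E, hℓ₁per, hA, hB, hQ, hE, n, ρ, cf, hρ, hcf, hmain⟩ :=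
    exists_family_normalForm L hL c hc hsupp
  -- the period of the normal form vanishes
  have hev : E + Q * (2 * Real.pi * I) + ∑ i, (2 * A i 0 * (L i).ω₁ + 2 * A i 1 * (L i).ω₂ +
      -2 * B i 0 * (L i).η₁ + -2 * B i 1 * (L i).η₂) = 0 := by
    have h1 := evalCombination_eq_zero_of_isElementaryRelation ρ cf hρ
    rw [← hmain, sub_eq_add_neg, evalCombination_add, h0, zero_add, ← neg_one_smul ℂ,
      evalCombination_smul, evalCombination_add, evalCombination_add, evalCombination_smul,
      evalCombination_smul, evalCombination_single, evalCombination_single, period_unit, hℓ₁per,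
      evalCombination_finsetSum, neg_one_mul, neg_eq_zero] at h1
    simp only [Ell.evalCombination_loopPart] at h1
    rw [← h1]
    have e : ∑ i, (2 * A i 0 * (L i).ω₁ + 2 * A i 1 * (L i).ω₂ + -2 * B i 0 * (L i).η₁ +
        -2 * B i 1 * (L i).η₂) = ∑ i, (2 * (A i 0 * (L i).ω₁ + A i 1 * (L i).ω₂) -
        2 * (B i 0 * (L i).η₁ + B i 1 * (L i).η₂)) :=
      Finset.sum_congr rfl fun i _ => by ring
    rw [e]
    ring
  -- Phase C: the isotypic splitting
  have h2 : IsAlgebraic ℚ (2 : ℂ) := isAlgebraic_nat 2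
  obtain ⟨hE0, hQ0, hblock⟩ := HuberWustholzIsotypicSplitting_holds k L hL E Q
    (fun i => 2 * A i 0) (fun i => 2 * A i 1) (fun i => -2 * B i 0) (fun i => -2 * B i 1) hE hQ
    (fun i => ⟨h2.mul (hA i 0), h2.mul (hA i 1), h2.neg.mul (hB i 0), h2.neg.mul (hB i 1)⟩) hev
  -- Phase D: the isogeny classes and their blocks
  set S : Fin k → Finset (Fin k) := fun i => Finset.univ.filter fun j => (L i).IsIsogenousTo (L j)
    with hS
  have hSmem : ∀ i j, j ∈ S i ↔ (L i).IsIsogenousTo (L j) := fun i j => by simp [hS]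
  have hclassSpan : ∀ i, ∃ (n : ℕ) (ρ : Fin n → (PeriodSymbol →₀ ℂ)) (a : Fin n → ℂ),
      (∀ l, IsElementaryRelation (ρ l)) ∧ (∀ l, IsAlgebraic ℚ (a l)) ∧
      ∑ j ∈ S i, Ell.loopPart (L j) (hL j).1 (hL j).2 (A j) (B j) = ∑ l, a l • ρ l := by
    intro i
    refine span_loopPart_class L hL (L i) (hL i).1 (hL i).2 (S i)
      (fun j hj => ((hSmem i j).1 hj).symm) A B hA hB ?_
    rw [← hblock i (S i) (hSmem i)]
    exact Finset.sum_congr rfl fun j _ => by ring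
  -- Phase E: reassembling the classes
  have hrefl : ∀ i, i ∈ S i := fun i => (hSmem i i).2 (PeriodPair.isIsogenousTo_refl _)
  have hclass : ∀ i j, j ∈ S i → S j = S i := fun i j hj => by
    have hij := (hSmem i j).1 hj
    ext l
    rw [hSmem, hSmem]
    exact ⟨fun h => hij.trans h, fun h => hij.symm.trans h⟩
  have hLPspan : ∃ (n : ℕ) (ρ : Fin n → (PeriodSymbol →₀ ℂ)) (a : Fin n → ℂ),
      (∀ l, IsElementaryRelation (ρ l)) ∧ (∀ l, IsAlgebraic ℚ (a l)) ∧
      ∑ j, Ell.loopPart (L j) (hL j).1 (hL j).2 (A j) (B j) = ∑ l, a l • ρ l := by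
    rw [sum_eq_sum_classes S hrefl hclass
      fun j => Ell.loopPart (L j) (hL j).1 (hL j).2 (A j) (B j)]
    exact span_finsetSum _ _ fun i _ => span_smul (isAlgebraic_nat _).inv (hclassSpan i)
  obtain ⟨n', ρ', cf', hρ', hcf', hfin⟩ := span_add ⟨n, ρ, cf, hρ, hcf, hmain⟩ hLPspan
  refine ⟨n', ρ', cf', hρ', hcf', ?_⟩
  rw [← hfin, hQ0, hE0, zero_smul, zero_smul, add_zero, add_zero, sub_add_cancel]

end Summit.KontsevichZagierPeriods.SymplecticScissors.RealOnePeriodRelations.LoopLayer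

end
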